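import Summits.BirchSwinnertonDyer.BirchSwinnertonDyer.Theorems.SchneiderFreeAdditiveX3LeafOfLZZMatch
import Summits.BirchSwinnertonDyer.BirchSwinnertonDyer.Theorems.SchneiderFreeAdditiveX3UpperCoSocketOfLZZMatch
import HarnessLib

/-!
# Route `SchneiderFreeAdditiveX3` (K1 door) + its wing: `MissingPPartAt` and Miller's `BSD(E, p)` on the WHOLE B6 ∩ X3 ∩ sst-twist,
# `r = 1` cell from `PrintedFacts`, the three remaining cruxes (door r2, wing r4, wing r2) and the LZZ/♭-road inputs —
# the (G-ord, `e = 2`) half of BOTH halves is now published-or-preprint complete, with NO sliver and NO value node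

Cell `bsd-schneider-ideate`, seat `bsd-schneider-door-c5` (prover, generation 20; assembly layer).  PARTITION: board row
B6 ∩ X3 ∩ sst-twist, `r = 1` (7 101 pairs; (M) 4 541 / (G-ord, `e = 2`) 2 560) of `Rank1Residual.partition`; types-the-object-of
nothing new; closes none of B6's cells (BSD NOT advanced).  bears_on: K1-door (items 18971/18972 → 19177 / 19176) + K1-wing
(20364 / 20365 / 20366).

p631992's `missingPPartAt_/bsdp_sstTwist_of_printedFacts_of_branchIMCs_of_coIMCs_of_twistUnit` took the door's r3
`GordTwoBranchIMC` and the wing's r3 `GordTwoBranchCoIMCField` as hypotheses.  Both (G-ord) cruxes are now supplied on the LZZ/♭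
road (this seat, generation 20): the lower LEAF by `additiveX3RankOneLower_of_printedFacts_of_potMult_of_hsieh_of_lzz_of_KY_of_castellaHsieh_signed`
(`…LeafOfLZZMatch`, p639417 — sliver-free: the leaf's datum has `d_K ≡ 1 (mod 8)`) and the upper LEAF by
`additiveX3RankOneUpper_of_printedFacts_of_potMultCo_of_twistUnit_of_hsieh_of_lzz_of_KY_branch_of_castellaHsieh_signed`
(`…UpperCoSocketOfLZZMatch`, p639248 — the wing crux is field-local off `d_K = −3`).  Pointwise composition
(`missingPPartAt_of_lower_of_upper`, `bsdp_of_missingPPartAt`) gives: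

  `MissingPPartAt W p` and `BSDp W p` at every `(W, p)` of the cell ⇐ `PrintedFacts` ∧ `PotMultBranchIMC` (door r2) ∧
  `PotMultBranchCoIMC` (wing r4) ∧ `TwistUnitX3OffSliver` (wing r2) ∧ Hsieh 2014 Thm. A ∧ Liu–Zhang–Zhang 2018 ∧
  Keller–Yin Thm. 3.5.1 (×3, PREPRINT) ∧ Castella–Hsieh signed existence.

INPUT LEDGER of the K1 rung's full residual after this file: the two (M)-half cruxes (door r2 / wing r4 — potentially
multiplicative reducible; NO printed input in either direction), the wing's twist-unit datum r2 (a certificate per pair), the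
Keller–Yin PREPRINT (three typed claims of one theorem), and PUBLISHED theorems (`PrintedFacts`, Hsieh 2014 Thm. A, Liu–Zhang–Zhang
2018 Thm 1.5.1/1.5.3, Castella–Hsieh 2018 Def. 3.7 + Prop. 3.8 signed).  GONE relative to p631992's six-hypothesis form on the
(G-ord) half: `CHFrameValueVOff` (NOT in print, 2 003 of 2 560 pairs), `KYReadCHValueUnit` (untyped), both slivers, Cai–Shu–Tian,
the scoped value fact V⁺, the CM-rationality input.

HONEST FRAMING: THEOREMS ONLY; two-line compositions of tree theorems; CONDITIONAL on the displayed hypotheses; this is NOT a proof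
of BSD for any curve — it is the K1 rung's residual in one statement; nothing is closed by me; «closes rung: none».
References: [Miller2011LMS] §1, Def. 1.1; [JetchevSkinnerWan2017] §7.4.1; [KellerYin2024b] arXiv:2410.23241 Thm. 3.5.1 (preprint);
[CastellaHsieh2018] §3.3, Def. 3.7, Prop. 3.8; [Hsieh2014] Thm. A; [LiuZhangZhang2018] Thm 1.5.1/1.5.3.
-/

set_option autoImplicit false
-- `Summit.<P>.<Sub>` repeats `BirchSwinnertonDyer` by the tree's layout convention (D-0017)
set_option linter.dupNamespace false

noncomputable section

open scoped Classical NumberField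

open Field NumberField IsDedekindDomain WeierstrassCurve
  Literature.NumberTheory.EllipticCurves Literature.NumberTheory.EllipticCurves.ModularForms
  Literature.NumberTheory.EllipticCurves.Rank1Residual Literature.NumberTheory.EllipticCurves.Rank1Residual.Typed
  Literature.NumberTheory.EllipticCurves.KellerYin2024
  Summit.BirchSwinnertonDyer.Rank1Residual
  Summit.BirchSwinnertonDyer.BirchSwinnertonDyer.Theorems.SchneiderFree
  Summit.BirchSwinnertonDyer.BirchSwinnertonDyer.Theorems.SchneiderFree.Upper
  Summit.BirchSwinnertonDyer.BirchSwinnertonDyer.Theses.SchneiderFreeAdditiveX3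

-- the wing route's crux decls, by name (its `PrintedFacts` is the door's, same body)
open Summit.BirchSwinnertonDyer.BirchSwinnertonDyer.Theses.SchneiderFreeAdditiveX3Upper
  (GordTwoBranchCoIMCField PotMultBranchCoIMC TwistUnitX3OffSliver)

namespace Summit.BirchSwinnertonDyer.BirchSwinnertonDyer.Theorems.SchneiderFreeAdditiveX3.ControlDischarged

/-- **The full rank-one residue `MissingPPartAt W p` (`ord_p #Ш(E)_an = ord_p #Ш(E)`) on B6 ∩ X3 ∩ sst-twist, `r = 1`, from
`PrintedFacts`, the door's crux r2, the wing's cruxes r4 / r2 and the LZZ/♭-road inputs** (Hsieh 2014 Thm. A, Liu–Zhang–Zhang 2018,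
Keller–Yin Thm. 3.5.1 ×3 (PREPRINT), Castella–Hsieh signed existence): the lower leaf (`…LeafOfLZZMatch`) and the upper leaf
(`…UpperCoSocketOfLZZMatch`) through `missingPPartAt_of_lower_of_upper`.  NO sliver (both leaves are sliver-free), NO value node,
NO Poitou–Tate binder (control corner CLOSED).  Conditional on the displayed hypotheses; closes nothing; BSD not advanced beyond this
typed reduction. [cite: JetchevSkinnerWan2017, §7.4.1 (arXiv:1512.06894 p. 30)] [cite: Miller2011LMS, Def. 1.1]
[cite: KellerYin2024b, Thm. 3.5.1 (arXiv:2410.23241 p. 20) (preprint; hypotheses)] -/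
theorem missingPPartAt_sstTwist_of_printedFacts_of_potMultCruxes_of_twistUnit_of_hsieh_of_lzz_of_KY_of_castellaHsieh_signed
    (hF : PrintedFacts)
    (h2 : PotMultBranchIMC) (hCoM : PotMultBranchCoIMC) (hTU : TwistUnitX3OffSliver)
    (hA : Hsieh2014.thmA_exists_isHsiehLFunction_unrPeriod_anyLevel)
    (hL : LiuZhangZhang2018.thm151_thm153_modularCurve_heegnerVector_additive)
    (hKY : thm351_imc_isTorsion_mu_zero_charIdeal_eq_OPEN) (hKYb : thm351_charIdeal_eq_branch_OPEN)
    (hKYμ : thm351_mu_zero_branch_OPEN) (hCHσ : castellaHsieh2018_exists_isBranchBDPLFunction_signed) :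
    ∀ (W : WeierstrassCurve ℚ) [W.IsElliptic] [W.IsGloballyMinimal] (p : ℕ) [Fact p.Prime],
      W.analyticRank = 1 → p ≠ 2 → ClassX3 W p → Additive.SubSemistableTwist W p → MissingPPartAt W p :=
  fun W _ _ p _ hr hp2 hX hS =>
    missingPPartAt_of_lower_of_upper W p
      (additiveX3RankOneLower_of_printedFacts_of_potMult_of_hsieh_of_lzz_of_KY_of_castellaHsieh_signed hF h2 hA hL hKY hKYb
        hKYμ hCHσ W p hr hp2 hX hS)
      (additiveX3RankOneUpper_of_printedFacts_of_potMultCo_of_twistUnit_of_hsieh_of_lzz_of_KY_branch_of_castellaHsieh_signed hF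
        hCoM hTU hA hL hKYb hCHσ W p hr hp2 hX hS)

/-- **Miller's `BSD(E, p)` on B6 ∩ X3 ∩ sst-twist, `r = 1`, from `PrintedFacts`, the three remaining cruxes (door r2, wing r4,
wing r2) and the LZZ/♭-road inputs** — the previous theorem through `bsdp_of_missingPPartAt` (rank = analytic rank and `Ш` finite
by GZK, conjunct 3 of `PrintedFacts`).  This is NOT a proof of BSD for any curve: it is the K1 rung's complete residual in one
statement, whose (G-ord, `e = 2`) half now rests on PUBLISHED theorems and Keller–Yin's PREPRINT only.
[cite: Miller2011LMS, §1 and Def. 1.1] [cite: Darmon2004, Thm. 3.22]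
[cite: KellerYin2024b, Thm. 3.5.1 (arXiv:2410.23241 p. 20) (preprint; hypotheses)] -/
theorem bsdp_sstTwist_of_printedFacts_of_potMultCruxes_of_twistUnit_of_hsieh_of_lzz_of_KY_of_castellaHsieh_signed
    (hF : PrintedFacts)
    (h2 : PotMultBranchIMC) (hCoM : PotMultBranchCoIMC) (hTU : TwistUnitX3OffSliver)
    (hA : Hsieh2014.thmA_exists_isHsiehLFunction_unrPeriod_anyLevel)
    (hL : LiuZhangZhang2018.thm151_thm153_modularCurve_heegnerVector_additive)
    (hKY : thm351_imc_isTorsion_mu_zero_charIdeal_eq_OPEN) (hKYb : thm351_charIdeal_eq_branch_OPEN)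
    (hKYμ : thm351_mu_zero_branch_OPEN) (hCHσ : castellaHsieh2018_exists_isBranchBDPLFunction_signed) :
    ∀ (W : WeierstrassCurve ℚ) [W.IsElliptic] [W.IsGloballyMinimal] (p : ℕ) [Fact p.Prime],
      W.analyticRank = 1 → p ≠ 2 → ClassX3 W p → Additive.SubSemistableTwist W p → BSDp W p :=
  fun W _ _ p _ hr hp2 hX hS =>
    bsdp_of_missingPPartAt W p hF.2.2.1 (le_of_eq hr)
      (missingPPartAt_sstTwist_of_printedFacts_of_potMultCruxes_of_twistUnit_of_hsieh_of_lzz_of_KY_of_castellaHsieh_signed hF h2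
        hCoM hTU hA hL hKY hKYb hKYμ hCHσ W p hr hp2 hX hS)

end Summit.BirchSwinnertonDyer.BirchSwinnertonDyer.Theorems.SchneiderFreeAdditiveX3.ControlDischarged

end
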